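import Summits.ValiantsHypothesis.ValiantsHypothesis.Theorems.BarrierLeverPartitionMinorsHitByVPRoabpDoor

/-!
# Route BarrierLever — item `PartitionMinorsHitByVP` (stmt-ValiantsHypothesis-19717):
# the ROABP door's NFA / TRIANGULAR-CERTIFICATE SUB-DOOR (combinatorial certificates, no genericity)

Helper file (`--supports stmt-ValiantsHypothesis-19717`; cell valiant-natproofs, rung V4, 𝒟-side; prover seat val-np-p7 g15,
sub-target (d) of the planner's round-3 owner table; the first two declarations are planner p1 g16's addendum
`RoabpTriangular_addendum.lean.txt` verbatim). Closes NO item.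

* `det_ne_zero_of_triangular`: a square matrix over a domain that is upper-triangular with nonzero diagonal after a row and a
  column permutation is nonsingular; `partitionMinor_hit_of_roabpTriangular`: the ROABP door
  (`RoabpDoor.partitionMinor_hit_of_roabpCertificate`) with a triangular certificate for its layout matrix `roabpCertMatrix`.
* COUNTING SEMANTICS for ℕ-valued («automaton») tables: the layout-matrix entry `l ⬝ᵥ (∏_t M_t) *ᵥ rr` over `ℂ` is the cast
  of the ℕ-valued one (`natCast_dotProduct_listProd_mulVec`, `roabpCertMatrix_natTables`), which is nonzero iff some state
  sequence has all its weights nonzero — an ACCEPTING RUN of the support automaton on the interleaved word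
  (`dotProduct_listProd_mulVec_ne_zero_iff`; the path expansion [ForbesShpilkaVolk2018 §5.3] read over ℕ).
* THE NFA SUB-DOOR `partitionMinor_hit_of_nfaPattern`: an ℕ-weighted automaton of width `m ≤ (2h)^c` that accepts every
  diagonal word `(u (ρ i), w (κ i))` and rejects every word `(u (ρ i), w (κ j))`, `j < i`, certifies the layout `(u, w)` inside
  `SmallCircuits ℂ (2h) (3c+3)` — the ℕ-valued tables themselves are the certificate (no generic weights; the «unique perfect
  matching» of MEMO-ttdoor-g16 §11b is taken in its triangular form, so no Lovász–Plummer step is needed).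

WHAT THIS IS NOT: not a proof of `ROABPHitsPartitionMinors` (open); nothing on crux 14610 or on VP ≠ VNP.
-/
namespace Summit.ValiantsHypothesis.Theorems.BarrierLever.RoabpDoor

open Matrix Finset Literature.Computability.AlgebraicComplexity

/-- **Triangular certificates** (the shape of every transparent / automaton class theorem): if, after reordering rows by `ρ`
and columns by `κ`, a square matrix over a domain is upper-triangular with nonzero diagonal, its determinant is nonzero. -/
theorem det_ne_zero_of_triangular {R : Type*} [CommRing R] [IsDomain R] {r : ℕ} (K : Matrix (Fin r) (Fin r) R)
    (ρ κ : Equiv.Perm (Fin r)) (htri : ∀ i j : Fin r, j < i → K (ρ i) (κ j) = 0) (hdiag : ∀ i, K (ρ i) (κ i) ≠ 0) :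
    K.det ≠ 0 := by
  have hsub : (K.submatrix ρ κ).det = Equiv.Perm.sign κ * (Equiv.Perm.sign ρ * K.det) := by
    rw [← Matrix.det_permute, ← Matrix.det_permute']
    rfl
  have htri' : (K.submatrix ρ κ).BlockTriangular id := fun i j hij => htri i j hij
  have hne : (K.submatrix ρ κ).det ≠ 0 := by
    rw [Matrix.det_of_upperTriangular htri']
    exact Finset.prod_ne_zero_iff.2 fun i _ => hdiag i
  rw [hsub] at hne
  intro hK
  apply hne
  rw [hK, mul_zero, mul_zero]

/-- **Sub-door for class theorems**: an ROABP certificate whose layout matrix is triangular after reordering (e.g. the run-count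
matrix of a nondeterministic automaton pattern whose support on `U × W` has a unique perfect matching, ordered along it). -/
theorem partitionMinor_hit_of_roabpTriangular (h m c : ℕ) (hm : m ≤ (h + h) ^ c) (hh : 4 ≤ h + h)
    {r : ℕ} (u w : Fin r → Finset (Fin h)) (π : Equiv.Perm (Fin (h + h)))
    (P Q : Fin (h + h) → Matrix (Fin m) (Fin m) ℂ) (l rr : Fin m → ℂ) (ρ κ : Equiv.Perm (Fin r))
    (htri : ∀ i j : Fin r, j < i → roabpCertMatrix u w π P Q l rr (ρ i) (κ j) = 0)
    (hdiag : ∀ i, roabpCertMatrix u w π P Q l rr (ρ i) (κ i) ≠ 0) :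
    ∃ f ∈ Literature.Barriers.ValiantsHypothesis.SmallCircuits ℂ (h + h) (3 * c + 3),
      (Matrix.of fun i j : Fin r => MvPolynomial.coeff
        (∑ a ∈ u i, Finsupp.single (Fin.castAdd h a) 1 + ∑ c ∈ w j, Finsupp.single (Fin.natAdd h c) 1) f).det ≠ 0 :=
  partitionMinor_hit_of_roabpCertificate h m c hm hh u w π P Q l rr
    (det_ne_zero_of_triangular _ ρ κ htri hdiag)

/-- **Counting semantics.** For ℕ-valued tables, the layout-matrix entry over `R` is the cast of the ℕ-valued one
(the number of weighted accepting runs of the support automaton). -/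
theorem natCast_dotProduct_listProd_mulVec {R : Type*} [CommSemiring R] {N w : ℕ}
    (M : Fin N → Matrix (Fin w) (Fin w) ℕ) (u v : Fin w → ℕ) :
    ((u ⬝ᵥ ((List.ofFn M).prod *ᵥ v) : ℕ) : R) =
      (fun a => (u a : R)) ⬝ᵥ ((List.ofFn fun i => (M i).map (Nat.cast : ℕ → R)).prod *ᵥ fun a => (v a : R)) := by
  rw [dotProduct_listProd_mulVec, dotProduct_listProd_mulVec]
  push_cast
  simp only [Matrix.map_apply]

/-- **Run semantics.** For ℕ-valued tables the entry is nonzero iff SOME state sequence has all its weights nonzero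
(an accepting run of the support automaton) — the path expansion [ForbesShpilkaVolk2018 §5.3] read over ℕ. -/
theorem dotProduct_listProd_mulVec_ne_zero_iff {N w : ℕ}
    (M : Fin N → Matrix (Fin w) (Fin w) ℕ) (u v : Fin w → ℕ) :
    u ⬝ᵥ ((List.ofFn M).prod *ᵥ v) ≠ 0 ↔
      ∃ p : Fin (N + 1) → Fin w, u (p 0) ≠ 0 ∧ (∀ i : Fin N, M i (p i.castSucc) (p i.succ) ≠ 0) ∧
        v (p (Fin.last N)) ≠ 0 := by
  rw [dotProduct_listProd_mulVec]
  constructor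
  · intro h
    obtain ⟨p, _, hp⟩ := Finset.exists_ne_zero_of_sum_ne_zero h
    refine ⟨p, ?_, ?_, ?_⟩
    · intro h0; apply hp; rw [h0]; simp
    · intro i hi; apply hp
      rw [Finset.prod_eq_zero (Finset.mem_univ i) hi]; simp
    · intro h0; apply hp; rw [h0]; simp
  · rintro ⟨p, h0, hM, hN⟩
    refine (Nat.pos_iff_ne_zero.1 ?_)
    refine lt_of_lt_of_le ?_ (Finset.single_le_sum (fun q _ => Nat.zero_le _) (Finset.mem_univ p))
    refine Nat.pos_of_ne_zero (mul_ne_zero (mul_ne_zero h0 ?_) hN)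
    exact Finset.prod_ne_zero_iff.2 fun i _ => hM i

/-- **ℕ-valued (automaton) tables in the door**: with tables `T t b ∈ ℕ^{m×m}` (bit `b` read at step `t`), start weights `l`
and accept weights `rr` cast to `ℂ`, the ROABP layout-matrix entry `(i, j)` is the cast of the ℕ-valued run count on the word
`t ↦ [π t ∈ monoVars (u i) (w j)]`. -/
theorem roabpCertMatrix_natTables {h m r : ℕ} (u w : Fin r → Finset (Fin h)) (π : Equiv.Perm (Fin (h + h)))
    (T : Fin (h + h) → Bool → Matrix (Fin m) (Fin m) ℕ) (l rr : Fin m → ℕ) (i j : Fin r) :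
    roabpCertMatrix u w π (fun t => (T t false).map (Nat.cast : ℕ → ℂ)) (fun t => (T t true).map (Nat.cast : ℕ → ℂ))
        (fun a => (l a : ℂ)) (fun a => (rr a : ℂ)) i j =
      ((l ⬝ᵥ ((List.ofFn fun t : Fin (h + h) => T t (decide (π t ∈ monoVars h (u i) (w j)))).prod *ᵥ rr) : ℕ) : ℂ) := by
  rw [roabpCertMatrix, Matrix.of_apply, natCast_dotProduct_listProd_mulVec]
  congr 4
  funext t
  by_cases ht : π t ∈ monoVars h (u i) (w j)
  · rw [if_pos ht, decide_eq_true ht]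
  · rw [if_neg ht, decide_eq_false ht]

/-- **THE NFA SUB-DOOR** (`--supports 19717`). An ℕ-weighted automaton pattern of width `m ≤ (2h)^c` (tables `T t b`, start
weights `l`, accept weights `rr`) on the interleaving `π`, together with a row order `ρ` and a column order `κ` of the layout such
that the automaton ACCEPTS every diagonal word `word(u (ρ i), w (κ i))` (some state sequence with all weights nonzero) and REJECTS
every word `word(u (ρ i), w (κ j))` with `j < i` (every state sequence meets a zero weight), certifies the layout `(u, w)`:
it is hit inside `SmallCircuits ℂ (2h) (3c+3)`. The ℕ-valued tables themselves are the certificate — no generic weights. -/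
theorem partitionMinor_hit_of_nfaPattern (h m c : ℕ) (hm : m ≤ (h + h) ^ c) (hh : 4 ≤ h + h)
    {r : ℕ} (u w : Fin r → Finset (Fin h)) (π : Equiv.Perm (Fin (h + h)))
    (T : Fin (h + h) → Bool → Matrix (Fin m) (Fin m) ℕ) (l rr : Fin m → ℕ) (ρ κ : Equiv.Perm (Fin r))
    (hacc : ∀ i, ∃ p : Fin (h + h + 1) → Fin m, l (p 0) ≠ 0 ∧
      (∀ t : Fin (h + h), T t (decide (π t ∈ monoVars h (u (ρ i)) (w (κ i)))) (p t.castSucc) (p t.succ) ≠ 0) ∧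
        rr (p (Fin.last (h + h))) ≠ 0)
    (hrej : ∀ i j, j < i → ∀ p : Fin (h + h + 1) → Fin m, l (p 0) = 0 ∨
      (∃ t : Fin (h + h), T t (decide (π t ∈ monoVars h (u (ρ i)) (w (κ j)))) (p t.castSucc) (p t.succ) = 0) ∨
        rr (p (Fin.last (h + h))) = 0) :
    ∃ f ∈ Literature.Barriers.ValiantsHypothesis.SmallCircuits ℂ (h + h) (3 * c + 3),
      (Matrix.of fun i j : Fin r => MvPolynomial.coeff
        (∑ a ∈ u i, Finsupp.single (Fin.castAdd h a) 1 + ∑ c ∈ w j, Finsupp.single (Fin.natAdd h c) 1) f).det ≠ 0 := by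
  refine partitionMinor_hit_of_roabpTriangular h m c hm hh u w π
    (fun t => (T t false).map (Nat.cast : ℕ → ℂ)) (fun t => (T t true).map (Nat.cast : ℕ → ℂ))
    (fun a => (l a : ℂ)) (fun a => (rr a : ℂ)) ρ κ (fun i j hij => ?_) (fun i => ?_)
  · rw [roabpCertMatrix_natTables, Nat.cast_eq_zero]
    by_contra hne
    obtain ⟨p, h0, hM, hN⟩ := (dotProduct_listProd_mulVec_ne_zero_iff _ _ _).1 hne
    rcases hrej i j hij p with h' | ⟨t, ht⟩ | h'
    · exact h0 h'
    · exact hM t ht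
    · exact hN h'
  · rw [roabpCertMatrix_natTables, Nat.cast_ne_zero, dotProduct_listProd_mulVec_ne_zero_iff]
    exact hacc i

end Summit.ValiantsHypothesis.Theorems.BarrierLever.RoabpDoor
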